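import Summits.FinalStateConjecture.FinalStateConjecture.Theses.ZeroEnergyKerrOrBomb
import Literature.Geometry.Lorentzian.TrivialDataAdmissible
import Summits.FinalStateConjecture.FinalStateConjecture.Theorems.ZeroEnergyKerrOrBombSymplecticDualOfTheBombDefs

/-!
# Disproof of `FinalStateFromKerrOrBomb` — findings (cdisprove seat, cycle 1, 2026-08-17)

Crux (item stmt-FinalStateConjecture-17839, route ZeroEnergyKerrOrBomb rev 9, rank 4):
`FinalStateFromKerrOrBomb : Prop := KerrOrBombModT → FinalStateConjecture` — the FRAME of the
route, successor of `StationaryLimitReduction` (stmt-10021, `KerrOrBomb → FinalStateConjecture`)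
re-pointed at the rev-6 target `KerrOrBombModT` and at the re-typed summit T2 (p126844: TAME
Christodoulou genericity on one fixed end, `RaysStayInClosure`, honest near-zone radii,
`IsFutureOriented`).

## Verdict of cycle 1: NO KILL — and why it resists

* `not_crux_iff` : `¬ FinalStateFromKerrOrBomb ↔ (KerrOrBombModT ∧ ¬ FinalStateConjecture)`.
  A disproof must (i) PROVE the route's target X = `KerrOrBombModT` (smooth stationary vacuum
  rigidity of Killing-mode-stable holes of the NTHR telescope — the open AIK problem conditioned on
  scalar mode stability) AND (ii) REFUTE the audited summit statement (T2).  Neither leg exists: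
  - leg (i) is not available VACUOUSLY either.  §6 below is the junk audit of the rev-6 telescope
    (new w.r.t. the predecessor's Disproof, whose target had `IsGloballyHyperbolic` of the whole
    carrier + `IsNonDegenerateHorizon`): every structural junk presentation I could think of
    (disconnected or mutilated carriers, horizon mutilation, deleted axes, `ℤ`/`ℤ_k`/antipodal
    quotients, time reversal, extreme / over-extreme / negative-mass Kerr, NUT charge, strutted
    multi-hole Weyl solutions) is excluded by a NAMED clause of the telescope, chiefly
    `IsIPlusRegular` = (T complete) ∧ (doc a globally hyperbolic SET) ∧ (a Def-1.1 hypersurface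
    whose boundary is a COMPACT cross-section of `𝓔⁺`), future-presentation `∀ p, p ∈ I⁺(M_ext)`,
    the Killing–timelike collar, and the `AFEnd` end structure (`{‖x‖ > R} ⊆ ℝ³`); sub-extremal
    Kerr/Schwarzschild inhabit it (on paper: `K = ∂_{t*} + Ω_H ∂_{φ*}`, `U = {r < r₊ + δ₀}`,
    `S₀ = ∅` for Schwarzschild); the instance binders `[HasLeviCivita] [Kerr.Facts]` are tree
    theorems; the conclusion's `Kerr.smoothMetric M a r₊` on `Kerr.exterior M a = {r > max r₊ 0}`
    is the genuine analytic Kerr metric (no smoothing junk).  So X is exactly as hard as it looks.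
  - leg (ii): admissible data exist (`trivialData_mem_admissibleVacuumData`), so `¬ FSC` needs a
    bad admissible datum through which NO tame immersed admissible curve of good data passes.  No
    MGHD is constructible in the tree, hence the only `¬ FSC` proof conceivable today is a UNIFORM
    (junk) failure of the T2 summit property on one admissible slice (`not_summit_of_forall_not`,
    re-derived here for the TAME genericity of T2 through the general
    `not_isTameChristodoulouGeneric_of_forall_not`).  I re-read the two T2 conjuncts that postdate
    the predecessor's four audits — `RaysStayInClosure` (horizon generators from `Σ` are limits of
    exterior points reaching the late near zone, rays to `𝓘⁺` and trapped rays lie in `O`) and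
    `IsFutureOriented` (orthochronous motions; `−g♯dt*` push-forwards) — against the expected
    `N = 0` Minkowski and `N = 1` Kerr pictures: satisfied.  No uniform failure found.
* Consequently the crux is, in every plausible world, EQUIVALENT to the summit
  (`crux_iff_summit_of_target`): it carries weak cosmic censorship, large-data settling and the
  genericity transfer.  Information for the lead, not a refutation.
* TREE DEFECTS NOTICED (for the operator): the landed predecessor files
  `Theorems/StationaryLimitReduction/Negative/KillShape.lean` (p72863; `lean check` 2026-08-17:
  application type mismatch at l.66 — its inlined summit property lacks
  `RaysStayInClosure`/`IsFutureOriented` and it destructures the old topology-free genericity) and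
  `Theorems/StationaryLimitReduction/Negative/FarFieldFocusing.lean` (p76008; type mismatch at l.205,
  `finalStateConjecture_of_escape` concludes the pre-T2 `IsChristodoulouGeneric`) no longer
  elaborate under the T2 summit.  §4 of this file is the T2 replacement of the former, stated through
  `IsTameChristodoulouGeneric` abstractly so that a further re-typing of the property cannot break it
  again; it is LANDED as `Theorems/FinalStateFromKerrOrBomb/Negative/KillShape.lean` (p134347).  The focusing file's checked lemmas other than `finalStateConjecture_of_escape` are
  summit-independent and still stand; under T2 the escape they call for must in addition be TAME and
  IMMERSED — §5 records why the packet train still escapes (thinning family).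

## Contents
* §1 logical skeleton (`crux_iff`, `not_crux_iff`, `crux_of_summit`, `crux_of_not_target`,
  `crux_iff_summit_of_target`, `crux_iff_or`).
* §2 load-bearing analysis: ONE hypothesis; dropping it gives the summit (`without_iff_summit`) —
  no `_false_without_` theorem can exist short of `¬ FinalStateConjecture`.
* §3 position in the route (pure logic, all kernel-checked): the frame vs the predecessor frame
  (`crux_of_stationaryLimitReduction`, `stationaryLimitReduction_of_crux` under the respective
  target comparisons, neither of which is available by logic — §6 says why) and vs the
  BRIDGE-FREE frame `F′ := NonTrappingHawkingRigidity → HawkingExtensionIsKerr → FSC` that both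
  round-1 idea cards (rays-not-modes, dock-on-the-cohypotheses) recommend: `bridgeFree_of_crux`
  (F ∧ ErgoregionBombModT → F′, via the landed glue) and `closes_of_bridgeFree` (F′ alone already
  decides the route with `hB`, `hF` unused).  This CERTIFIES the ideators' "X idles" remark in the
  only form logic can: modulo crux #3 the served frame and the bridge-free frame are
  inter-derivable (`crux_iff_bridgeFree_of_bomb`), so a line for this item may take `hN`, `hD` by
  name without loss, and conversely nothing is gained for `closes` by routing through X.
* §4 the T2 summit unfolded (`SummitProperty`, `summit_iff` by `Iff.rfl`) and the only shape a kill
  can take in this tree: `not_isTameChristodoulouGeneric_of_forall_not` (general, any `m ≠ 0`),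
  `not_summit_of_forall_not`, `not_summit_of_forall_not_slice`, `not_crux_of`.
* §5 natural strengthenings: the pointwise reduction `CruxPointwise := X → FinalStatePointwise`
  implies the crux (`crux_of_pointwise`); believed FALSE for the reasons of the predecessor's §4/§7
  (threshold data, exactly-extremal final states, far-field focusing packets — the last is NOT cured
  by T2's tameness: a tame immersed curve `c ↦ D + c f₀ + Σₙ θₙ(c)·packetₙ` thins the train and
  escapes, so the summit survives focusing but the pointwise property still fails); nothing
  constructible, recorded as definitions.
* §6 (prose) junk audit of the rev-6 telescope of X, clause by clause.
* §7 (prose) what a proof of the frame must supply to USE X at a limit hole, clause by clause, with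
  tree status — and the scalar-probe debt.
* `-- Targets` (§8, added 2026-08-17T00:58Z after the lead PICKED `SketchIdeator1` = shape m1,
  `Lines/SketchIdeator1.lean`, 7 stubs, and named three disprover targets in `PICKED.md`): (a) honesty of
  `InTelescopeModT ∧ ModeStable` on Kerr — HONEST on paper, clause list below; (b) the ray clause of
  `Sig7.stub_chartTransferT2` — reduces to a cofinality statement, no junk instance (Minkowski `N = 0`
  satisfies both sides); (c) 5′ `SigM.stub_dualModeEjectionModT` — no vanishing-detector collapse
  (kernel: `Targets.isLocalSliceTangentAt_of_forall_eq_zero`, `Targets.not_areDetectorsAt_of_forall_eq_zero`,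
  LANDED as `Negative/VanishingDetectors.lean` p134793), `k = 0` excluded by the window injectivity,
  symmetric bombs routed to 2′ by the KID-free hypothesis; (d) FINDING for the lead: the m1 currency
  `Q := ModeStableModT` keeps X load-bearing at the price of a hidden open input — every FRONT stub
  (2′, 5′) that certifies its cured members by "settles to Kerr" must ALSO prove `ModeStable` of the Kerr
  presentation (Whiting mode stability IN THE ABSTRACT TELESCOPE: item KerrModeStability stmt-10024 is
  open in tree, proved only modulo DRSR boundedness p91353, and `doc = {r > r₊}` for
  `Kerr.stationaryAFBlackHole` is not in tree); with `Q := InTelescopeModT ∧ IsKerrExterior` both X and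
  that input drop out (§3: X idles).  No target is broken.

## §6 Junk audit of the telescope of `KerrOrBombModT` (leg (i) cannot be had vacuously, and X
cannot be refuted by junk)

X = `∀ 𝓑 [HasLeviCivita] [Kerr.Facts], Ric = 0 → IsIPlusRegular → (∀ p, p ∈ I⁺(M_ext)) →
(T ≠ 0 on doc) → SimplyConnectedSpace doc → ∀ U K, IsOpen U → 𝓔⁺ ⊆ U → IsConnected 𝓔⁺ →
(K smooth, Killing, [T,K] = 0 on U) → (K ≠ 0 on 𝓔⁺) → (K-flow preserves 𝓔⁺) →
(g(K,K) < 0 on U ∩ doc) → (belt compact mod T) → (Killing-mode-stable) → doc ≅ Kerr exterior`.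
Candidate junk presentations and the clause that kills each (all on paper; no `StationaryAFBlackHole`
other than `Kerr.stationaryAFBlackHole(On)` is constructible, and even for it `doc = {r > r₊}` is not
in the tree):

| junk presentation | killed by |
|---|---|
| carrier = Kerr ⊔ W (disconnected; `Spacetime` does not ask connectedness beyond `[ConnectedSpace]`? — it does: `Spacetime.connectedSpace`) and anyway | future-presentation: points of W ∉ I⁺(M_ext) |
| Kerr chart with a closed T-invariant set removed from the INTERIOR `{r < r₊}` | nothing — but doc, 𝓔⁺ and the conclusion are unchanged: not a counterexample (shows only that X does not see the interior; cf. `KerrOrBomb`'s GH-of-carrier clause, which did) |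
| … removed from the EXTERIOR (a T-orbit of a point / of a far half-axis) | `IsIPlusRegular`.2: causal diamonds of doc straddling the hole are not compact |
| … removed from the HORIZON (polar caps of generators) | `IsIPlusRegular`.3: `closure S = K ∪ ends`, `K` compact, forces the cross-section `closure S ∖ S` to be relatively compact, hence (projection to the generator space continuous and onto) the generator space of `𝓔⁺` compact — false for `ℝ × (S² ∖ caps)` |
| whole north semi-axis removed (doc stays simply connected!) | same: the pole generator is missing from `𝓔⁺`, generator space `S² ∖ pt` non-compact |
| quotient by a time translation `t* ↦ t* + P` | `IsIPlusRegular`.2: strong causality fails on doc (closed T-orbits); NB mode stability holds there trivially (`KerrOrBomb/Negative/ModeStabilityAnatomy`: closed orbits ⇒ no `ν > 0` pair) |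
| quotient by `ℤ_k` rotations | axis becomes an orbifold line: not a manifold; axis removed ⇒ GH of doc fails |
| antipodal quotient `(θ, φ*) ↦ (π − θ, φ* + π)` (free, isometric, commutes with T: a smooth Ricci-flat stationary NON-ORIENTABLE hole with end `ℝ × ℝP²`) | `SimplyConnectedSpace doc` (`π₁ = ℤ₂`); independently the structure's `e : AFEnd X` (end chart `{‖x‖ > R} ⊆ ℝ³`, i.e. `S² × (R, ∞)`) with `embed` injective: a spacelike AF end in the quotient lifts to two disjoint antipodal copies in Kerr's far region, impossible for asymptotic graphs (Borsuk–Ulam on large spheres) |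
| reversed time orientation on the ingoing chart | `𝓔⁺ = ∂doc ∩ I⁺(M_ext)` becomes empty (`IsConnected 𝓔⁺` fails) and interior points ∉ I⁺(M_ext) |
| extreme Kerr `|a| = M` | collar: `g(T + cΦ, T + cΦ)|_{𝓗⁺} = g_{φφ}(c − Ω_H)² ≥ 0` forces `c = Ω_H`, and for `a = M` the Hawking field is spacelike just outside `𝓗⁺` on `sin θ > √3 − 1` (route file NUMBERS) |
| `|a| > M`, `M < 0`, the `r < 0` sheet | no horizon (`IsConnected 𝓔⁺` ⇒ nonempty) |
| Taub–NUT / Kerr–NUT | Misner string: either CTCs (strong causality) or a singular axis (not a manifold / GH fails); `k`-fall-off of `AFEnd.IsAsymptoticallyFlat` fails at the string |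
| double-Kerr / Weyl multi-hole with strut | strut removed ⇒ GH of doc fails; kept ⇒ not smooth; also `IsConnected 𝓔⁺` |
| `killing := λT`, `λ > 0`, or `T + cΦ` | `T + cΦ` is spacelike far out on `M_ext` (unbounded), so `c = 0`; rescaling is harmless (`KerrOrBomb/Negative/ModeStabilityRescaling`) |
| a bent / boosted slice `X`, odd end `e` | enters only through `M_ext ⊇ T-orbit of a full far region`; `doc = I⁺(M_ext) ∩ I⁻(M_ext)` is the Kerr exterior regardless |

Upshot: the telescope is tight against structural junk; a counterexample to X is a genuinely new
smooth stationary AF vacuum black hole (scalar-mode-stable, non-Kerr) — 'dark hair' — and a proof of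
X is smooth rigidity.  Neither is this seat's to produce.

## §7 What the frame must supply to USE X at a late-time limit hole (clause checklist, tree status)

A proof of `X → FSC` applies X to each stationary limit `𝓑ᵢ` of a generic development.  Per clause:
`Ric = 0` (limit of vacuum: needs `C²` convergence — the summit's `k = 2` is exactly enough);
`IsIPlusRegular` (GH of doc: from global hyperbolicity of the MGHD only if the limit is taken INSIDE
one development — it is not: the limit is a new spacetime; needs a construction; Def-1.1
hypersurface with compact cross-section: needs the event horizon of the LIMIT to be a smooth null
hypersurface with spherical sections); future-presentation (WLOG by re-presentation: LANDED p115302);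
`T ≠ 0` on doc (Chruściel–Costa Cor. 3.8 from GH: landed `killing_ne_zero_of_mem_doc_of_isGloballyHyperbolic`
for GH of the CARRIER — the telescope only has GH of doc: small gap); `SimplyConnectedSpace doc`
(topological censorship, Friedman–Schleich–Witt / Chruściel–Wald 1994: NOT in tree; needs GH of doc +
null energy condition (vacuum ✓) + `𝓘` structure); collar `(U, K)` (smooth LOCAL rigidity near a
non-degenerate horizon, Alexakis–Ionescu–Klainerman 2010 / Petersen–Rácz: NOT in tree; AND
non-degeneracy `κ > 0` of the LIMIT horizon = a generic dynamical third law — NOT in tree, open in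
vacuum); belt compact mod T (from AF fall-off + the collar: T timelike far out and the closed
ergoregion meets `𝓗⁺` only inside U — needs `g(T,T) → −1` uniformly at the end: fine);
Killing-MODE-STABILITY of the limit (the SCALAR probe: `□_g`-modes are not vacuum dynamics; every
round-1 card and the predecessor's triage flag this as the frame's one mechanism-less debt —
`stub_probeUniversality` of line r7; the bridge-free re-cut of §3 removes it at the price of making
`hX` idle).  Finally the OUTPUT of X (an abstract isometry `Ψ : Kerr.exterior M a → 𝓑ᵢ.carrier` onto
doc) must be turned into the summit's ingoing-Kerr–Schild late charts with `C²` convergence, honest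
radii, exhaustiveness and future orientation: the landed pattern `stub_chartTransfer` p120456 was
typed against the PRE-T2 summit (no `RaysStayInClosure`/`IsFutureOriented`) — to be re-checked by the
line that uses it (cf. the stale KillShape above: T2 silently broke at least one landed file).
-/

set_option linter.dupNamespace false
set_option maxSynthPendingDepth 3

noncomputable section

namespace Summit.FinalStateConjecture.FinalStateConjecture.Cruxes.FinalStateFromKerrOrBomb.Disproof

open Summit.FinalStateConjecture.FinalStateConjecture.Theses.ZeroEnergyKerrOrBomb
open Literature.Geometry.Lorentzian
open scoped Manifold ContDiff Topology BigOperators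
open Set Bundle

/-! ## §1 Logical skeleton -/

/-- The crux is literally the implication target → summit. -/
theorem crux_iff : FinalStateFromKerrOrBomb ↔ (KerrOrBombModT → _root_.FinalStateConjecture) :=
  Iff.rfl

/-- WHY IT RESISTS: a disproof of the crux is exactly a proof of the route's target together with a
refutation of the summit statement. -/
theorem not_crux_iff :
    ¬ FinalStateFromKerrOrBomb ↔ (KerrOrBombModT ∧ ¬ _root_.FinalStateConjecture) :=
  Classical.not_imp

/-- The crux follows from the summit (so it is at most as hard as the summit). -/
theorem crux_of_summit (h : _root_.FinalStateConjecture) : FinalStateFromKerrOrBomb :=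
  fun _ ↦ h

/-- The crux follows from the negation of the target: a refutation of `KerrOrBombModT` ('dark hair':
a smooth scalar-mode-stable non-Kerr vacuum hole in the telescope) would close this item trivially
and break the route at its target instead.  §6 of the module docstring: no JUNK refutation of the
target exists. -/
theorem crux_of_not_target (h : ¬ KerrOrBombModT) : FinalStateFromKerrOrBomb :=
  fun hX ↦ absurd hX h

/-- Once the route has proved its target (its whole point), the crux IS the summit. -/
theorem crux_iff_summit_of_target (hX : KerrOrBombModT) :
    FinalStateFromKerrOrBomb ↔ _root_.FinalStateConjecture :=
  ⟨fun h ↦ h hX, fun h _ ↦ h⟩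

/-- The crux is the disjunction "target false or summit true". -/
theorem crux_iff_or : FinalStateFromKerrOrBomb ↔ (¬ KerrOrBombModT ∨ _root_.FinalStateConjecture) :=
  imp_iff_not_or

/-! ## §2 Load-bearing analysis

ONE hypothesis, `KerrOrBombModT`.  Dropping it leaves the summit statement itself. -/

/-- The crux with its only hypothesis dropped: the summit. -/
def FinalStateFromKerrOrBombWithoutTarget : Prop := _root_.FinalStateConjecture

/-- Dropping `KerrOrBombModT` from the crux gives exactly `FinalStateConjecture`. -/
theorem without_iff_summit :
    FinalStateFromKerrOrBombWithoutTarget ↔ _root_.FinalStateConjecture := Iff.rfl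

/-- … hence a `_false_without_` theorem for this crux would be a refutation of the summit. -/
theorem not_without_iff :
    ¬ FinalStateFromKerrOrBombWithoutTarget ↔ ¬ _root_.FinalStateConjecture := Iff.rfl

/-! ## §3 Position in the route: predecessor frame, bridge-free frame -/

/-- If the rev-6 target implied the rev-4 target (it does NOT by logic: `KerrOrBomb`'s telescope asks
`IsGloballyHyperbolic` of the whole CARRIER and a global horizon Killing field
`IsNonDegenerateHorizon`, neither of which the collar telescope supplies), the predecessor frame would
give this one. -/
theorem crux_of_stationaryLimitReduction (himp : KerrOrBombModT → KerrOrBomb)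
    (h : StationaryLimitReduction) : FinalStateFromKerrOrBomb :=
  fun hX ↦ h (himp hX)

/-- Conversely, if the rev-4 target implied the rev-6 one (again not by logic: `IsIPlusRegular`,
simple connectivity of doc and the collar are not consequences of GH + `IsNonDegenerateHorizon` in the
tree), this frame would give the predecessor frame. -/
theorem stationaryLimitReduction_of_crux (himp : KerrOrBomb → KerrOrBombModT)
    (h : FinalStateFromKerrOrBomb) : StationaryLimitReduction :=
  fun hX ↦ h (himp hX)

/-- The **bridge-free frame** both round-1 idea cards recommend (rays-not-modes `opticalDock`,
dock-on-the-cohypotheses `trappedRay_of_not_kerr`): dock the limits on the two rigidity cruxes that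
`closes` holds anyway, never routing through the scalar mode-stability antecedent of X. -/
def BridgeFreeFrame : Prop :=
  NonTrappingHawkingRigidity → HawkingExtensionIsKerr → _root_.FinalStateConjecture

/-- The glue of the rev-6 target (the body of the landed `KerrOrBombModTOfCruxes_proof`, p-closed
item stmt-17841; re-proved here to keep this work file on the route module alone). -/
theorem target_of_cruxes (hN : NonTrappingHawkingRigidity) (hD : HawkingExtensionIsKerr)
    (hB : ErgoregionBombModT) : KerrOrBombModT := by
  intro 𝓑 _ _ hRic hreg hfut hT hsc U K hUo hHU hconn hKs hKill hcomm hne htan hcollar hbelt hms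
  refine hD 𝓑 hRic hreg hfut hT hsc U K hUo hHU hconn hKs hKill hcomm hne htan hcollar
    (hN 𝓑 hRic hreg hfut hT hsc U K hUo hHU hconn hKs hKill hcomm hne htan hcollar hbelt ?_)
  intro S hS hSd γ s hγ hs hnull
  by_contra hcon
  have hcon' : ∀ t ∈ s, γ t ∈ stationaryOrbit 𝓑.killing S :=
    fun t ht ↦ Classical.by_contradiction fun h ↦ hcon ⟨t, ht, h⟩
  obtain ⟨ν, w, ψ, χ, hν, hU, hwave, hmode, hbdd, x, hx, hnz⟩ :=
    hB 𝓑 hRic hreg hfut hT hsc U K hUo hHU hconn hKs hKill hcomm hne htan hcollar hbelt S hS hSd γ s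
      hγ hs hnull hcon'
  have hzero := hms ν w ψ χ hν hU hwave hmode hbdd x hx
  rcases hnz with h | h
  · exact h hzero.1
  · exact h hzero.2

/-- **F ∧ #3 ⇒ F′.**  Given the bomb crux `ErgoregionBombModT`, the served frame implies the
bridge-free frame. -/
theorem bridgeFree_of_crux (hB : ErgoregionBombModT) (hF : FinalStateFromKerrOrBomb) :
    BridgeFreeFrame :=
  fun hN hD ↦ hF (target_of_cruxes hN hD hB)

/-- **F′ decides the route by itself**: with the bridge-free frame in hand, `closes`'s hypotheses
`hB : ErgoregionBombModT` and `hF : FinalStateFromKerrOrBomb` are not needed (the scalar bomb and the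
served frame both IDLE).  This is the ideators' "X idles" remark, certified in the only form logic
allows. -/
theorem closes_of_bridgeFree (h : BridgeFreeFrame) (hN : NonTrappingHawkingRigidity)
    (hD : HawkingExtensionIsKerr) : _root_.FinalStateConjecture :=
  h hN hD

/-- **F′ ⇒ F modulo the two rigidity cruxes** (trivially: F′ with `hN`, `hD` proves the summit). -/
theorem crux_of_bridgeFree (h : BridgeFreeFrame) (hN : NonTrappingHawkingRigidity)
    (hD : HawkingExtensionIsKerr) : FinalStateFromKerrOrBomb :=
  crux_of_summit (h hN hD)

/-- Modulo crux #3 and in the presence of the two rigidity co-hypotheses of `closes`, the served frame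
and the bridge-free frame are inter-derivable. -/
theorem crux_iff_bridgeFree_of_bomb (hB : ErgoregionBombModT) (hN : NonTrappingHawkingRigidity)
    (hD : HawkingExtensionIsKerr) : FinalStateFromKerrOrBomb ↔ BridgeFreeFrame :=
  ⟨bridgeFree_of_crux hB, fun h ↦ crux_of_bridgeFree h hN hD⟩

/-! ## §4 The T2 summit unfolded, and the only available shape of a kill -/

/-- The property `P(D)` the T2 summit asserts tame-generically of admissible data `D` on the slice
`X` (verbatim the lambda of `FinalStateConjecture`): an MGHD exists, and every MGHD has complete `𝓘⁺`
and an exhaustive, future-oriented, sub-extremal `N`-Kerr final-state decomposition of its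
self-determined exterior, every future-complete ray from the data staying in its closure. -/
def SummitProperty (X : Type) [TopologicalSpace X] [ChartedSpace E3 X] [IsManifold (𝓡 3) ∞ X]
    [ConnectedSpace X] (D : InitialDataSet (𝓡 3) X) : Prop :=
  (∃ 𝒟 : VacuumCauchyDevelopment D, 𝒟.IsMaximal) ∧
    ∀ 𝒟 : VacuumCauchyDevelopment D, 𝒟.IsMaximal →
      Summit.FinalStateConjecture.HasCompleteNullInfinity 𝒟.toCauchyDevelopment ∧
        ∃ (O : Set 𝒟.carrier) (d : FinalStateDecomposition 𝒟.toSpacetime O 2),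
          (∀ i, Kerr.IsSubextremal (d.mass i) (d.spin i)) ∧
            O = Summit.FinalStateConjecture.exteriorOf 𝒟.toCauchyDevelopment d.charted ∧
              Summit.FinalStateConjecture.RaysStayInClosure 𝒟.toCauchyDevelopment O ∧
                Summit.FinalStateConjecture.HasExhaustiveCharts d ∧
                  Summit.FinalStateConjecture.IsFutureOriented d

/-- The T2 summit, unfolded: TAME Christodoulou-genericity (codimension 1) of `SummitProperty` inside
the admissible class, for every connected Hausdorff second-countable smooth 3-manifold. -/
theorem summit_iff :
    _root_.FinalStateConjecture ↔
      ∀ (X : Type) [TopologicalSpace X] [ChartedSpace E3 X] [IsManifold (𝓡 3) ∞ X] [T2Space X]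
        [SecondCountableTopology X] [ConnectedSpace X],
        InitialDataSet.IsTameChristodoulouGeneric (admissibleVacuumData X) (SummitProperty X) 1 :=
  Iff.rfl

/-- **Uniform failure kills tame genericity** (general; any positive number of parameters): if the
admissible class `𝓓` has a member and `P` fails on ALL of `𝓓`, then `P` is not tame-generic in `𝓓`
— the witnessing family through a bad datum consists of admissible, hence bad, data. -/
theorem not_isTameChristodoulouGeneric_of_forall_not {X : Type} [TopologicalSpace X]
    [ChartedSpace E3 X] [IsManifold (𝓡 3) ∞ X] {𝓓 : Set (InitialDataSet (𝓡 3) X)}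
    {P : InitialDataSet (𝓡 3) X → Prop} {D : InitialDataSet (𝓡 3) X} (hD : D ∈ 𝓓)
    (h : ∀ D' ∈ 𝓓, ¬ P D') {m : ℕ} (hm : m ≠ 0) :
    ¬ InitialDataSet.IsTameChristodoulouGeneric 𝓓 P m := by
  intro hG
  obtain ⟨e, F, -, -, -, -, hF𝓓, hgood⟩ := hG D ⟨hD, h D hD⟩
  exact hgood (EuclideanSpace.single ⟨0, Nat.pos_of_ne_zero hm⟩ 1) (by simp)
    ⟨hF𝓓 _, h _ (hF𝓓 _)⟩

/-- THE ONLY SHAPE OF A KILL OF THE SUMMIT AVAILABLE IN THIS TREE (T2 form): a uniform failure of the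
summit property on one slice carrying an admissible datum. -/
theorem not_summit_of_forall_not {X : Type} [TopologicalSpace X] [ChartedSpace E3 X]
    [IsManifold (𝓡 3) ∞ X] [T2Space X] [SecondCountableTopology X] [ConnectedSpace X]
    {D : InitialDataSet (𝓡 3) X} (hD : D ∈ admissibleVacuumData X)
    (h : ∀ D' ∈ admissibleVacuumData X, ¬ SummitProperty X D') : ¬ _root_.FinalStateConjecture :=
  fun hF ↦ not_isTameChristodoulouGeneric_of_forall_not hD h one_ne_zero (hF X)

/-- Specialisation to the Minkowski slice `ℝ³`, which carries the proved-admissible trivial data.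
(Expected NOT to hold: `P(trivialData)` is `N = 0` dispersal of Minkowski space, true modulo the
un-constructed maximality of Minkowski as a development; the T2 clauses `RaysStayInClosure`,
`HasExhaustiveCharts`, `IsFutureOriented` hold for the identity chart on `{x⁰ > τ₀}`, `O = {x⁰ ≥ 0}`.) -/
theorem not_summit_of_forall_not_slice
    (h : ∀ D ∈ admissibleVacuumData Minkowski.slice, ¬ SummitProperty Minkowski.slice D) :
    ¬ _root_.FinalStateConjecture :=
  not_summit_of_forall_not trivialData_mem_admissibleVacuumData h

/-- The precise shape of the only conceivable kill of THIS crux in the tree: a proof of the target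
plus a uniform failure of the T2 summit property on the Minkowski slice.  Both inputs are out of
reach (module docstring). -/
theorem not_crux_of (hX : KerrOrBombModT)
    (h : ∀ D ∈ admissibleVacuumData Minkowski.slice, ¬ SummitProperty Minkowski.slice D) :
    ¬ FinalStateFromKerrOrBomb :=
  not_crux_iff.2 ⟨hX, not_summit_of_forall_not_slice h⟩

/-! ## §5 Natural strengthenings -/

/-- The POINTWISE (non-generic) T2 final-state statement: every admissible datum satisfies `P`. -/
def FinalStatePointwise : Prop :=
  ∀ (X : Type) [TopologicalSpace X] [ChartedSpace E3 X] [IsManifold (𝓡 3) ∞ X] [T2Space X]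
    [SecondCountableTopology X] [ConnectedSpace X], ∀ D ∈ admissibleVacuumData X, SummitProperty X D

/-- The pointwise statement implies the summit (empty exceptional set). -/
theorem summit_of_pointwise (h : FinalStatePointwise) : _root_.FinalStateConjecture :=
  fun X _ _ _ _ _ _ ↦ InitialDataSet.isTameChristodoulouGeneric_of_forall (h X) 1

/-- The pointwise strengthening of the crux.  BELIEVED FALSE (genericity is load-bearing: threshold
data, exactly-extremal final states break `IsSubextremal`, far-field focusing packets break `C²`
settling pointwise — predecessor Disproof §7, landed `StationaryLimitReduction/Negative/FarFieldFocusing`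
p76008; T2's tameness does not rescue the POINTWISE property, only the escape), and not refutable in
the tree (no admissible counterexample datum is constructible): recorded as a definition.

WHY T2 STILL LETS THE PACKET TRAIN ESCAPE (paper, refuter-level).  For `D₀ = D + Σₙ packetₙ`
(packets at radii `rₙ ↑ ∞`, pairwise disjoint supports, DR-weighted sizes `εₙ → 0`, frequencies
`ωₙ` as large as wanted) take `F c := D + c f₀ + Σₙ θₙ(c) packetₙ` (+ the perturbative constraint
correction), `f₀` a fixed compactly supported constraint-compatible direction off the packets, `θₙ`
smooth, `θₙ = 1` on `|c| ≤ n⁻²`, `θₙ = 0` on `|c| ≥ 2n⁻²`.  Then: (tame) `wDist(F c, F 0) ≤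
|c|‖f₀‖ + sup_{n > |c|^{-1/2}} εₙ → 0`, masses continuous; (jointly smooth) near `c₀ ≠ 0` only the
finitely many `n ∈ (|c|^{-1/2}, (2/|c|)^{1/2})` vary, near `c₀ = 0` the packet supports are locally
finite in `x` and each `θₙ · packetₙ` is smooth in `(c, x)`; (immersed) `∂_c F|₀ = f₀ ≠ 0` since
`θₙ'(0) = 0`; (injective) through `c f₀`; (members) for `c ≠ 0` only the packets with
`n ≤ (2/|c|)^{1/2}` survive — FINITELY many foci of finite strength, after which the development is
that of `D + c f₀` up to a compactly supported finite-energy perturbation: good iff such data are good,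
which is the summit's own content.  A curve whose tail packets do NOT thin out (e.g. `D₀ + c f₀`)
keeps infinitely many foci for every `c` and is no witness; a GENERIC-CAUSTIC remark: an `O(c)`
near-zone perturbation defocuses packet `n` from a point focus (`ω¹` gain) to stable caustics (folds
`ω^{1/6}`, cusps `ω^{1/4}`), which still blow up `C²` once `ωₙ ≫ rₙ^{12}` — so it is the THINNING,
not the immersion direction, that makes the witness. -/
def CruxPointwise : Prop := KerrOrBombModT → FinalStatePointwise

/-- The pointwise strengthening implies the crux. -/
theorem crux_of_pointwise (h : CruxPointwise) : FinalStateFromKerrOrBomb :=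
  fun hX ↦ summit_of_pointwise (h hX)

/-- A refutation of the pointwise strengthening again needs the target (leg (i)). -/
theorem not_pointwise_iff : ¬ CruxPointwise ↔ (KerrOrBombModT ∧ ¬ FinalStatePointwise) :=
  Classical.not_imp

/-! ## §8 `-- Targets`: line m1 = `Lines/SketchIdeator1.lean` (lead lineage 0, PICKED 2026-08-17T00:55Z)

The composition `FinalStateFromKerrOrBomb_of : MGHDExists → 7 stubs → FinalStateFromKerrOrBomb` is
kernel-checked (rc 0, 7 sorries = the stubs).  X = `KerrOrBombModT` is consumed ONLY inside
`summitPropertyT2_of_settlesDocWithT2` (the dock of GOOD members: a limit hole with `InTelescopeModT ∧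
ModeStable` is a Kerr exterior).  Attacks on the three targets named by the lead, and one finding.

**T(a) `InTelescopeModT ∧ ModeStable` is HONEST on Kerr** (paper; nothing about `doc`/`𝓔⁺` of
`Kerr.stationaryAFBlackHole` is in the tree, so no Lean instance either way).  For sub-extremal
`𝓑 = Kerr.stationaryAFBlackHole M a δ` (ingoing chart `{r > r₊ − δ}`, `0 < δ < r₊ − r₋`): vacuum ✓;
`IsIPlusRegular`: `∂_{t*}` complete ✓, `doc = {r > r₊}` is a globally hyperbolic SET (diamonds compact:
inside `𝓗⁺` the radius decreases along future causal curves, so no diamond of two exterior points leaves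
the exterior) ✓, Def-1.1 hypersurface `S = {t* = 0, r > r₊}`, `closure S ∖ S = {t* = 0, r = r₊}` a
compact cross-section (each generator has constant `θ` and meets `t* = 0` once) ✓; future-presented: every
point of `{r > r₊ − δ}`, interior and early ones included, is reached from the far past of `M_ext` by an
infalling timelike curve ✓; `T ≠ 0` ✓; `π₁(doc) = 0` (`ℝ × (r₊, ∞) × S²`) ✓; collar: `U = {r < r₊ + δ₀(a)}`
(T-INVARIANT, which answers the lead's parenthesis), `K = ∂_{t*} + Ω_H ∂_{φ*}`: open, `⊇ 𝓔⁺`, `𝓔⁺`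
connected, `K` smooth Killing, `[T, K] = 0`, `K ≠ 0` on `𝓔⁺`, `K`-flow preserves `𝓔⁺` (both `T` and `Φ`
do), `g(K, K) < 0` on `r₊ < r < r₊ + δ₀` (route NUMBERS: `δ₀ = 0.64M, 0.12M, 0.032M` at `a/M = 0.9,
0.99, 0.999`; Schwarzschild: `K = T`, any `δ₀`) ✓; belt: `S₀ = {t* = 0} ∩ {r ≥ r₊ + δ₀, r² + a² cos²θ ≤
2Mr}` compact, its T-orbit is the closed ergoregion off `U` ✓ (`S₀ = ∅` for Schwarzschild);
`ModeStable`: Whiting 1989 / Shlapentokh-Rothman 2015 — TRUE, but see T(d) for its status in the tree.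
The rev-4 `InTelescope (d.hole i)` that the currency still carries asks in addition global hyperbolicity
of the CARRIER `{r > r₊ − δ}` (true for `r₊ − δ > r₋` by the same monotonicity) and `IsNonDegenerateHorizon`
(the global Hawking field) ✓.  So the Kerr limit of a cured member is presentable in the m1 currency.

**T(b) the ray clause of `Sig7.stub_chartTransferT2`.**  Hypothesis: `RaysStayInClosure 𝒟 (O ∩
I⁻(docCharted d))`; wanted: `RaysStayInClosure 𝒟 O'`, `O' = exteriorOf 𝒟 d'.charted = J⁺(Σ) ∩
I⁻(d'.charted)`.  Since `closure` is monotone it suffices that `O ∩ I⁻(docCharted d) ⊆ O'`, i.e. (the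
`J⁺(Σ)` factor being common) `I⁻(docCharted d) ⊆ I⁻(d'.charted)`, i.e. COFINALITY: `docCharted d ⊆
J⁻(d'.charted)` — every point of the stationary charts' d.o.c. images is causally below some recut late
image point.  For honest decompositions this holds because `I⁺(q)` of a d.o.c. point `q` contains all
sufficiently late far points (outgoing timelike curves) and the recut flat/near-zone late images are
cofinal in chart time (`KerrSchildRecutCovering` (ii) + `HasExhaustiveDocCharts'` (ii)); it does NOT
follow from `C²`-closeness alone (a recut whose late images were, say, empty in some hole would break it —
but the recut images are non-empty late slabs by construction, honest radii `R ≥ max(r₊,0)+1`).  No junk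
instance refutes the stub: its hypotheses need a `StationaryFinalStateDecomposition` of a concrete
development; the one development constructible in the tree (`Minkowski.vacuumCauchyDevelopment`, `N = 0`)
satisfies hypotheses AND conclusion with the identity flat chart (`O = O' = {x⁰ ≥ 0}`).  Verdict: honest,
load-bearing sub-claim = cofinality; recommend the 1F-T2 worker state it as a named intermediate.

**T(c) 5′ `SigM.stub_dualModeEjectionModT`.**  (i) Symmetric bombs: excluded by the hypothesis
`∃ x, IsKIDFreeAt 𝒟 x` and routed to 2′ (right disjunct) — the repair of the wave-1 collapse is in place
(`AreSymmDetectorsAt` = symmetric ∧ `IsKIDFreeAt` ∧ `AreDetectorsAt`).  (ii) Degenerate detectors: the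
`k = 0` loophole is closed by the window injectivity clause (a curve inside a `0`-parameter family is
constant; cf. landed `not_injOn_ball_of_forall_mem_range_fin0` for the `|c 0|` norm — the `‖c‖` version is
identical); the VANISHING-detector loophole (all `A j, B j` zero near `x₀`, so every `chartPairing` at `x₀`
vanishes and the steering clause is vacuous) is closed by the non-gauge clause of `AreDetectorsAt`:
`Targets.isLocalSliceTangentAt_of_forall_eq_zero` / `Targets.not_areDetectorsAt_of_forall_eq_zero` below
(the trivial deformation `ι_s = ι` realises `(0, 0)` as a slice tangent).  (iii) What protects 5′ from a
junk PROOF by ill-chosen non-gauge detectors is stub 4 (`LocalSingleDetectionAt`) JOINTLY: any detector set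
5′ outputs is fed to `moncriefTransversality_of_facts`, which returns a family with non-singular pairing,
so the steering clause is exercised; a detector set with universally singular pairing would refute stub 4,
not discharge 5′.  (iv) No junk refutation: needs a concrete MGHD with a bomb.  Verdict: as typed, 5′
carries its intended content; its open debts are the ones its docstring lists (dual-mode transport,
saddle, fate, spiral obstruction).

**T(d) FINDING — the price of keeping X load-bearing (for the lead and the tenure planner).**  In m1 the
good-member currency is `Q := ModeStableModT = InTelescopeModT ∧ ModeStable`, and X turns it into
`IsKerrExterior` at the dock.  But a prover of 2′/5′ can CERTIFY `ModeStable` of the limit holes of its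
cured members only through wave theory on the limit background that the tree does not have: in practice —
the cured limits being (sub-extremal) KERR by Kerr stability — through Whiting's mode stability
transported into the abstract telescope, `WhitingInTelescope := ∀ 𝓑, InTelescopeModT 𝓑 → IsKerrExterior 𝓑
→ ModeStable 𝓑` (or, equivalently hard, through forward test-wave boundedness on the development passed
to the limit — the DRSR-type input that `KerrModeStability` is itself proved modulo).  That
statement is NOT in the tree: `KerrModeStability` (stmt-10024, chart form) is open (p91353 proves it
modulo the DRSR boundedness facts), and its transport needs `doc = {r > r₊}` / `𝓔⁺ = {r = r₊}` for
`Kerr.stationaryAFBlackHole` (not in tree) plus presentation-independence of the mode bound (true: §6 last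
row and the remark that outgoing modes are bounded on `I⁻` of any AF far slice region).  Under X ∧
WhitingInTelescope the two currencies coincide (`InTelescopeModT ∧ ModeStable ↔ InTelescopeModT ∧
IsKerrExterior`, pure logic), so m1 = (m1 with `Q := InTelescopeModT ∧ IsKerrExterior`) + X +
WhitingInTelescope, and in the re-cut currency NEITHER X NOR Whiting is needed (the dock is the identity).
Hence: keeping the crux's hypothesis load-bearing costs the line one extra open item (Whiting in the
telescope) and buys nothing for `closes` — the quantitative form of §3's "X idles".  Recommendation: if the
lead keeps m1, file `WhitingInTelescope` (or "cured members settle to ModeStable holes" as an explicit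
clause of 2′/5′'s docstrings) so the debt is visible; otherwise re-cut `Q`. -/

namespace Targets

open Summit.FinalStateConjecture.FinalStateConjecture.Theorems.SymplecticDualOfTheBomb

variable {X : Type} [TopologicalSpace X] [ChartedSpace E3 X] [IsManifold (𝓡 3) ∞ X]
  [ConnectedSpace X] {D : InitialDataSet (𝓡 3) X}

/-- **T(c-ii) A pair vanishing near `x₀` is a local slice tangent at `x₀`** (the trivial deformation
`ι_s := ι`, `ν_s := ν`).  Copy of the lemma landed as `Negative/VanishingDetectors.lean` (p134793). -/
theorem isLocalSliceTangentAt_of_forall_eq_zero (𝒟 : VacuumCauchyDevelopment D) {A B : BilinField X}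
    {x₀ : X} {V : Set X} (hV : IsOpen V) (hx₀ : x₀ ∈ V) (hA : ∀ y ∈ V, A y = 0)
    (hB : ∀ y ∈ V, B y = 0) : IsLocalSliceTangentAt 𝒟 A B x₀ := by
  refine ⟨V, 1, hV, hx₀, one_pos, fun _ ↦ 𝒟.embed, fun _ ↦ 𝒟.normal, rfl, ?_, ?_, ?_⟩
  · exact (𝒟.isSmoothEmbedding.contMDiff.comp contMDiff_snd).contMDiffOn
  · intro s _ y _
    obtain ⟨⟨hnormal, hunit⟩, hfut⟩ := 𝒟.isFutureUnitNormal
    exact ⟨fun v ↦ hnormal y v, hunit y, hfut y⟩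
  · intro y hy v w
    have hA0 : A y v w = 0 := by rw [hA y hy]; rfl
    have hB0 : B y v w = 0 := by rw [hB y hy]; rfl
    rw [hA0, hB0]
    exact ⟨hasDerivAt_const 0 _, hasDerivAt_const 0 _⟩

/-- **T(c-ii) Locally vanishing detectors are not detectors** (`k ≥ 1`): the non-gauge clause of
`AreDetectorsAt` fails for the coefficient vector `e_{j₀}`. -/
theorem not_areDetectorsAt_of_forall_eq_zero (𝒟 : VacuumCauchyDevelopment D) {x₀ : X} {k : ℕ}
    {A B : Fin k → BilinField X} (j₀ : Fin k) {V : Set X} (hV : IsOpen V) (hx₀ : x₀ ∈ V)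
    (hA : ∀ j, ∀ y ∈ V, A j y = 0) (hB : ∀ j, ∀ y ∈ V, B j y = 0) : ¬ AreDetectorsAt 𝒟 x₀ A B := by
  rintro ⟨-, -, hng⟩
  have hne : (Pi.single j₀ 1 : Fin k → ℝ) ≠ 0 := fun h ↦ by simpa using congrFun h j₀
  refine hng (Pi.single j₀ 1) hne (isLocalSliceTangentAt_of_forall_eq_zero 𝒟 hV hx₀ ?_ ?_)
  · intro y hy
    exact Finset.sum_eq_zero fun j _ ↦ by rw [hA j y hy, smul_zero]
  · intro y hy
    exact Finset.sum_eq_zero fun j _ ↦ by rw [hB j y hy, smul_zero]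

/-- **T(d) the currency swap, abstractly**: for predicates `T` (telescope), `M` (mode-stable), `K` (Kerr)
on holes, the dock shape `T → M → K` (X) and the Whiting shape `T → K → M` make the two good-member
currencies `T ∧ M` and `T ∧ K` coincide — so a line that can only certify `M` through `K` gains nothing
from routing through X. -/
theorem currency_iff_of_dock_of_whiting {T M K : StationaryAFBlackHole.{0} → Prop}
    (hX : ∀ 𝓑, T 𝓑 → M 𝓑 → K 𝓑) (hW : ∀ 𝓑, T 𝓑 → K 𝓑 → M 𝓑) (𝓑 : StationaryAFBlackHole.{0}) :
    (T 𝓑 ∧ M 𝓑) ↔ (T 𝓑 ∧ K 𝓑) :=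
  ⟨fun h ↦ ⟨h.1, hX 𝓑 h.1 h.2⟩, fun h ↦ ⟨h.1, hW 𝓑 h.1 h.2⟩⟩

end Targets

end Summit.FinalStateConjecture.FinalStateConjecture.Cruxes.FinalStateFromKerrOrBomb.Disproof

end
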